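import Literature.AlgebraicGeometry.HodgeTheory.LefschetzPrimitivePartsSemiconj
import Literature.AlgebraicGeometry.HodgeTheory.SmoothFamilyFibreClasses
import Literature.AlgebraicGeometry.Motives.SmoothSpread
import Literature.AlgebraicGeometry.HodgeTheory.GysinBaseChangeOfKunneth
import Literature.AlgebraicGeometry.HodgeTheory.HyperplaneSectionMonodromySmoothLocus
import Literature.AlgebraicGeometry.HodgeTheory.AlgebraicClassesHodgeTypeHolds
import HarnessLib

/-!
# Primitive parts of global classes on a smooth projective family are restrictions of global classes
# (from Voisin II Thm. 4.18), and the top-degree Gysin map of a fibre is injective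

Family `hodge`, layer `Literature/AlgebraicGeometry/HodgeTheory`, sub-namespace
`…HodgeTheory.SmoothFamilyGysinKernel`. THEOREMS ONLY (no definition, no named fact). Second file of the
Literature home of the discharge of `Deligne1971_fibreGysin_injOn_restricted` (`SmoothFamilyFibreClasses`;
apex `SmoothFamilyGysinKernelHolds`). Setting: an ARBITRARY smooth projective family `f : 𝒳 ⟶ S` of relative
dimension `n` over a smooth projective base `S` of dimension `m` with smooth projective total space `𝒳` —
the exact hypotheses of that fact; `h418 = deligne1968_invariantClass_fromTotalSpace` (Voisin II Thm. 4.18 /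
Deligne 1968 (2.1)+(2.6.3), a THEOREM of the tree, `InvariantClassesFromTotalSpaceHolds`) displayed where used.

## Content

* §1 `dim_total_eq_add`: the total space has dimension `N = n + m` (uniqueness of the relative dimension of a
  smooth morphism, the tree's `SmoothSpread.eq_of_smoothOfRelativeDimension`).
* §2 **`complexGysin_fiberι_top_injective`** — `j_{t*} : H^{2n}(X_t(ℂ); ℂ) → H^{2(n+m)}(𝒳(ℂ); ℂ)` is
  injective: `[X_t] = j_{t*} 1 ≠ 0` (Wirtinger), the cup pairing of `𝒳(ℂ)` is perfect
  (`isPerfPair_cupPairing_of_field_holds`), `j_{t*} j_t^* x = x ∪ [X_t]` (projection formula), and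
  `H^{2n}(X_t(ℂ); ℂ)` is a line.
* §3 `exists_globalKaehlerClass_family` — one global `K ∈ H²(𝒳(ℂ); ℂ)` restricting on `X_t` to the Kähler
  class of a Kähler–rational datum and with hard Lefschetz on every fibre.
* §4 `continuous_primitivePartSection_family`, **`exists_primitivePart_map_fiberι_eq_family (h418)`** —
  the primitive parts of a global class form a continuous section of `FiberClass f a`; hence, by `h418`,
  `Im j_t^*` is stable under the primitive projections (the transports intertwine the primitive parts,
  `LefschetzPrimitivePartsSemiconj`).

Provenance: Literature home of the Summits-side `Theorems/Ring2AbelianAllAndreSmoothFamilyPrimitiveParts`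
(cell Ring 2 · AbelianAll, André axis), which `Literature/` may not import. Lane `lit-hodgefound`, seat p20.

## References

* [VoisinHodgeII2003] C. Voisin, Hodge Theory and Complex Algebraic Geometry II, CUP 2003, Thm. 4.15,
  Lemma 4.17, Thm. 4.18.
* [Deligne1968] P. Deligne, Théorème de Lefschetz et critères de dégénérescence de suites spectrales,
  Publ. Math. IHÉS 35 (1968), (2.1), (2.6.3).
* [VoisinHodgeI2002] C. Voisin, Hodge Theory and Complex Algebraic Geometry I, CUP 2002, Cor. 6.26,
  Thm. 6.25, §7.1.2, Thm. 9.3.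
* [HatcherAT2002] A. Hatcher, Algebraic Topology, CUP 2002, §3.3 Thm. 3.26, Prop. 3.38.
* [FultonYoungTableaux1997] W. Fulton, Young Tableaux, CUP 1997, App. B (5)–(6).
* [GriffithsHarrisPrinciples1978] P. Griffiths, J. Harris, Principles of Algebraic Geometry, Ch. 0 §7.
* [GortzWedhorn2020] U. Görtz, T. Wedhorn, Algebraic Geometry I, 2nd ed., Prop. 6.15, Lemma 6.26.
-/

noncomputable section

open CategoryTheory AlgebraicGeometry MonoidalCategory
open _root_.Topology _root_.Filter
open Literature.AlgebraicGeometry Literature.AlgebraicGeometry.Motives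
open Literature.AlgebraicGeometry.HodgeTheory
open Literature.AlgebraicTopology.SingularHomology (singularCohomology cupProduct cupProduct_map cupPairing
  cupProduct_one isPerfPair_cupPairing_of_field_holds)
open Literature.Geometry.Kaehler (lefschetzOperator HasHardLefschetzProperty)

namespace Literature.AlgebraicGeometry.HodgeTheory.SmoothFamilyGysinKernel

variable {n m N : ℕ} {𝒳 S : SchemeOver ℂ} {f : 𝒳 ⟶ S}

/-! ## §1 The dimension of the total space -/

/-- **`dim 𝒳 = n + m`** for a smooth projective family of relative dimension `n` over a smooth base of
dimension `m` with smooth projective total space of dimension `N`: `𝒳 → Spec ℂ` is smooth of relative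
dimension `N` and, as `𝒳 → S → Spec ℂ`, of relative dimension `n + m`; the relative dimension of a smooth
morphism with non-empty source is unique. [cite: GortzWedhorn2020, I Prop. 6.15 (1) and Lemma 6.26] -/
theorem dim_total_eq_add (hS : IsSmoothProjective m S) (hf : IsSmoothProjectiveFamily f n)
    (h𝒳 : IsSmoothProjective N 𝒳) : N = n + m := by
  haveI := h𝒳.smoothOfRelativeDimension
  haveI := hf.smoothOfRelativeDimension
  haveI := hS.smoothOfRelativeDimension
  haveI : SmoothOfRelativeDimension (n + m) 𝒳.hom := by
    rw [← Over.w f]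
    infer_instance
  haveI := connectedSpace_complexPoints h𝒳
  obtain ⟨P⟩ : Nonempty (ComplexPoints 𝒳) := inferInstance
  exact SmoothSpread.eq_of_smoothOfRelativeDimension 𝒳.hom P.pt

/-- `Hᵏ(X_s(ℂ); ℂ) = 0` for `k > 2n` on every fibre. [cite: HatcherAT2002, §3.3 (Prop. 3.29)] -/
theorem hvan_fibre (hf : IsSmoothProjectiveFamily f n) (s : ComplexPoints S) :
    ∀ k, 2 * n < k → Subsingleton (complexBetti (fiberOver f s) k) :=
  subsingleton_of_lt (hf.isSmoothProjective s) ℂ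

/-! ## §2 The top-degree Gysin map of a fibre is injective -/

/-- **`[X_t] = j_{t*} 1 ≠ 0` in `H^{2m}(𝒳(ℂ); ℂ)`** (the fibre inclusion is a closed immersion of the non-empty
smooth projective `X_t`; Wirtinger, `complexGysin_one_ne_zero_of_stalkMap_surjective`).
[cite: GriffithsHarrisPrinciples1978, Ch. 0 §7 pp. 109–111] [cite: FultonYoungTableaux1997, Appendix B §B.1 (5)] -/
theorem complexGysin_fiberι_one_ne_zero (hS : IsSmoothProjective m S) (hf : IsSmoothProjectiveFamily f n)
    (h𝒳 : IsSmoothProjective (n + m) 𝒳) (t : ComplexPoints S) :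
    complexGysin complexOrientationFamily (hf.isSmoothProjective t) h𝒳 (fiberι f t)
      (show 0 + 2 * (n + m) = 2 * m + 2 * n by ring) (singularCohomology.one ℂ (ComplexPoints (fiberOver f t))) ≠ 0 := by
  haveI : IsProper S.hom := IsSmoothProjective.isProper_holds hS
  haveI : IsClosedImmersion (fiberι f t).left := isClosedImmersion_fiberι_left f t
  haveI := connectedSpace_complexPoints (hf.isSmoothProjective t)
  obtain ⟨P⟩ : Nonempty (ComplexPoints (fiberOver f t)) := inferInstance
  exact complexGysin_one_ne_zero_of_stalkMap_surjective complexOrientationFamily h𝒳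
    (hf.isSmoothProjective t) (fiberι f t) P ((fiberι f t).left.stalkMap_surjective P.pt) (e := m) rfl

/-- **Some `x ∈ H^{2n}(𝒳(ℂ); ℂ)` has `j_{t*} j_t^* x = x ∪ [X_t] ≠ 0`** (perfect cup pairing of the closed oriented
`2(n+m)`-manifold `𝒳(ℂ)`, `[X_t] ≠ 0`, projection formula `j_{t*}(j_t^* x ∪ 1) = x ∪ j_{t*} 1`).
[cite: HatcherAT2002, §3.3 Prop. 3.38] [cite: FultonYoungTableaux1997, Appendix B §B.1 (6)] -/
theorem exists_complexGysin_map_fiberι_top_ne_zero (hS : IsSmoothProjective m S) (hf : IsSmoothProjectiveFamily f n)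
    (h𝒳 : IsSmoothProjective (n + m) 𝒳) (t : ComplexPoints S) :
    ∃ x : complexBetti 𝒳 (2 * n), complexGysin complexOrientationFamily (hf.isSmoothProjective t) h𝒳 (fiberι f t)
      (show 2 * n + 2 * (n + m) = 2 * (n + m) + 2 * n by ring) (complexBetti.map (fiberι f t) (2 * n) x) ≠ 0 := by
  by_contra hall
  push Not at hall
  apply complexGysin_fiberι_one_ne_zero hS hf h𝒳 t
  letI := h𝒳.chartedSpace
  haveI := Motives.ComplexPoints.compactSpace_of_isSmoothProjective h𝒳
  haveI := Motives.ComplexPoints.t2Space_of_isSmoothProjective h𝒳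
  have hdeg : 2 * n + 2 * m = 2 * (n + m) := by ring
  have hP : (cupPairing (complexOrientationFamily h𝒳) hdeg).IsPerfPair := isPerfPair_cupPairing_of_field_holds
  refine (LinearMap.IsPerfPair.bijective_right (cupPairing (complexOrientationFamily h𝒳) hdeg)).1 ?_
  rw [map_zero]
  ext x
  -- `x ∪ j_* 1 = j_*(j^* x ∪ 1) = j_* j^* x = 0`
  have hproj := complexGysin_cup (μ := complexOrientationFamily) hasPoincareDuality_complexOrientationFamily
    (hf.isSmoothProjective t) h𝒳 (fiberι f t) (Nat.add_zero (2 * n))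
    (show 2 * n + 2 * (n + m) = 2 * (n + m) + 2 * n by ring)
    (show 0 + 2 * (n + m) = 2 * m + 2 * n by ring) hdeg x (singularCohomology.one ℂ (ComplexPoints (fiberOver f t)))
  rw [cupProduct_one] at hproj
  rw [LinearMap.flip_apply, LinearMap.zero_apply,
    Literature.AlgebraicTopology.SingularHomology.cupPairing_apply, ← hproj, hall x, map_zero, LinearMap.zero_apply]

/-- **`j_{t*}` is injective on the top degree `H^{2n}(X_t(ℂ); ℂ)` of every fibre** of a smooth projective
family with smooth projective total space over a smooth projective base (the top degree is the line through
`j_t^* x`, `exists_eq_smul_of_top`). [cite: HatcherAT2002, §3.3 Thm. 3.26 and Prop. 3.38] -/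
theorem complexGysin_fiberι_top_injective (hS : IsSmoothProjective m S) (hf : IsSmoothProjectiveFamily f n)
    (h𝒳 : IsSmoothProjective (n + m) 𝒳) (t : ComplexPoints S) {a : complexBetti (fiberOver f t) (2 * n)}
    (ha : complexGysin complexOrientationFamily (hf.isSmoothProjective t) h𝒳 (fiberι f t)
      (show 2 * n + 2 * (n + m) = 2 * (n + m) + 2 * n by ring) a = 0) : a = 0 := by
  obtain ⟨x, hx⟩ := exists_complexGysin_map_fiberι_top_ne_zero hS hf h𝒳 t
  have hx0 : complexBetti.map (fiberι f t) (2 * n) x ≠ 0 := fun h0 ↦ hx (by rw [h0, map_zero])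
  obtain ⟨c, rfl⟩ := exists_eq_smul_of_top complexOrientationFamily (hf.isSmoothProjective t) hx0 a
  rw [map_smul] at ha
  rcases smul_eq_zero.1 ha with hc | h
  · rw [hc, zero_smul]
  · exact (hx h).elim

/-! ## §3 One global class polarising every fibre -/

/-- **A class with the hard Lefschetz property in dimension `n ≥ 1` on a fibre is non-zero** (`Lⁿ : H⁰ → H^{2n}`
is onto the non-zero top degree; `Lⁿ_0 = 0`). [cite: VoisinHodgeI2002, Thm. 6.25] -/
theorem ne_zero_of_hasHardLefschetzProperty_fibre (hS : IsSmoothProjective m S) (hf : IsSmoothProjectiveFamily f n)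
    (h𝒳 : IsSmoothProjective (n + m) 𝒳) (hn : 1 ≤ n) (t : ComplexPoints S)
    {κ : complexBetti (fiberOver f t) 2} (hκ : HasHardLefschetzProperty κ n) : κ ≠ 0 := by
  rintro rfl
  obtain ⟨x, hx⟩ := exists_complexGysin_map_fiberι_top_ne_zero hS hf h𝒳 t
  have hx0 : complexBetti.map (fiberι f t) (2 * n) x ≠ 0 := fun h0 ↦ hx (by rw [h0, map_zero])
  obtain ⟨n', rfl⟩ : ∃ n', n = n' + 1 := ⟨n - 1, by omega⟩
  have hbij := bijective_lefschetzPowTo_of_hasHardLefschetz (0 : complexBetti (fiberOver f t) 2) hκ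
    (show 0 + (n' + 1) = n' + 1 by omega) (2 * (n' + 1)) (by omega)
  obtain ⟨y, hy⟩ := hbij.2 (complexBetti.map (fiberι f t) (2 * (n' + 1)) x)
  apply hx0
  rw [← hy, lefschetzPowTo_succ_apply (0 : complexBetti (fiberOver f t) 2) n' 0 (0 + 2 * n') (2 * (n' + 1)) rfl
      (by omega) (by omega), Literature.Geometry.Kaehler.lefschetzOperator_apply, LinearMap.map_zero,
    LinearMap.zero_apply]

/-- **One global class polarising every fibre** (general family): for `n ≥ 1` and a point `t`, a class
`K ∈ H²(𝒳(ℂ); ℂ)` whose restriction to `X_t` is the rational Kähler class of a Kähler–rational datum of `X_t`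
and whose restriction to every fibre has the hard Lefschetz property (`𝒳 ↪ ℙᴺ`; the closed immersions
`X_s ↪ 𝒳 → ℙᴺ`; `exists_kaehlerRationalDatum_eq_map`; the non-zero class spans `H²(ℙᴺ(ℂ); ℂ)`;
`hasHardLefschetzProperty_map_of_forall_eq_smul`). [cite: VoisinHodgeII2003, §4.2.3 Thm. 4.15]
[cite: VoisinHodgeI2002, Thm. 6.25, Thm. 7.10 and §7.1.2] -/
theorem exists_globalKaehlerClass_family (hS : IsSmoothProjective m S) (hf : IsSmoothProjectiveFamily f n)
    (h𝒳 : IsSmoothProjective (n + m) 𝒳) (hn : 1 ≤ n) (t : ComplexPoints S) :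
    ∃ (K : complexBetti 𝒳 2) (D : KaehlerRationalDatum n (fiberOver f t)),
      complexBetti.map (fiberι f t) 2 K = D.Hη ∧
        ∀ s : ComplexPoints S, HasHardLefschetzProperty (complexBetti.map (fiberι f s) 2 K) n := by
  obtain ⟨N', ε, hε⟩ := IsQuasiProjectiveOver.exists_isPreimmersion
    (IsQuasiProjectiveOver.of_isProjectiveOver h𝒳.isProjectiveOver)
  haveI := hε
  haveI : IsProper S.hom := IsSmoothProjective.isProper_holds hS
  haveI : IsProper f.left := hf.isProper
  have hcl : ∀ s : ComplexPoints S, IsClosedImmersion (fiberι f s ≫ ε).left := fun s ↦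
    isClosedImmersion_fiberι_comp_left_of_isPreimmersion f ε s
  haveI := hcl t
  obtain ⟨D, c, hc⟩ := exists_kaehlerRationalDatum_eq_map (hf.isSmoothProjective t) (fiberι f t ≫ ε)
  refine ⟨complexBetti.map ε 2 c, D, ?_, fun s ↦ ?_⟩
  · rw [hc, complexBetti.map_comp, CategoryTheory.comp_apply]
  · have hc0 : c ≠ 0 := by
      intro h0
      refine ne_zero_of_hasHardLefschetzProperty_fibre hS hf h𝒳 hn t (D.hLℂ (hf.isSmoothProjective t)) ?_
      rw [hc, h0, map_zero]
    obtain ⟨r₀, -, hr₀⟩ := exists_isRationalClass_forall_eq_smul_projectiveSpace N'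
    obtain ⟨z, hz⟩ := hr₀ c
    have hz0 : z ≠ 0 := by
      rintro rfl
      exact hc0 (by rw [hz, zero_smul])
    have hgen : ∀ c' : complexBetti (projectiveSpace N' ℂ) 2, ∃ w : ℂ, c' = w • c := fun c' ↦ by
      obtain ⟨z', hz'⟩ := hr₀ c'
      exact ⟨z' * z⁻¹, by rw [hz', hz, smul_smul, mul_assoc, inv_mul_cancel₀ hz0, mul_one]⟩
    haveI := hcl s
    have hHL := hasHardLefschetzProperty_map_of_forall_eq_smul (hf.isSmoothProjective s) (fiberι f s ≫ ε) hgen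
    have e : complexBetti.map (fiberι f s) 2 (complexBetti.map ε 2 c) = complexBetti.map (fiberι f s ≫ ε) 2 c := by
      rw [complexBetti.map_comp, CategoryTheory.comp_apply]
    rw [e]
    exact hHL

/-! ## §4 Flat primitive parts; stability of `Im j_t^*` under the primitive projections (from `h418`) -/

/-- **Flatness of the primitive parts** (general family over a smooth projective base of dimension `m`): for a
global `K` with hard Lefschetz on every fibre, a global `A ∈ Hⁱ(𝒳(ℂ); ℂ)` and a Lefschetz index `P`, the section
`s ↦ (s, ξ_P^{(s)}(A|_{X_s}))` of `FiberClass f a` is continuous (Ehresmann tubes; the transports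
`r_s ∘ r_{s₀}⁻¹` intertwine the primitive parts, `map_primitivePart_of_semiconj`). [cite: VoisinHodgeI2002, §9.2.1 (with Thm. 9.3) and §6.2.3 Cor. 6.26] -/
theorem continuous_primitivePartSection_family (hS : IsSmoothProjective m S) (hf : IsSmoothProjectiveFamily f n)
    (K : complexBetti 𝒳 2) (hK : ∀ s : ComplexPoints S, HasHardLefschetzProperty (complexBetti.map (fiberι f s) 2 K) n)
    {i : ℕ} (A : complexBetti 𝒳 i) (P : {p : ℕ × ℕ // p.1 + 2 * p.2 = i}) :
    Continuous fun s : ComplexPoints S ↦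
      (⟨s, primitivePart (complexBetti.map (fiberι f s) 2 K) n (hK s) (hvan_fibre hf s) P
        (complexBetti.map (fiberι f s) i A)⟩ : FiberClass f P.1.1) := by
  haveI := hS.smoothOfRelativeDimension
  have hU := isCohomologicallyLocallyTrivialOn_univ_of_isSmoothProjectiveFamily f m hf
    (IsQuasiProjectiveOver.of_isProjectiveOver hS.isProjectiveOver)
  refine continuous_iff_continuousAt.2 fun s₀ ↦ ?_
  obtain ⟨B, hBo, hs₀B, -, -, hbij⟩ := hU.exists_nhds_bijective (Set.mem_univ s₀) Set.univ univ_mem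
  let rinv : ∀ j, complexBetti (fiberOver f s₀) j → singularCohomology ℂ ℂ (tubeOver f B) j :=
    fun j ↦ (Equiv.ofBijective _ (hbij j hs₀B)).symm
  have hrinv : ∀ j (y : complexBetti (fiberOver f s₀) j), fiberRestrict f hs₀B j (rinv j y) = y :=
    fun j y ↦ Equiv.ofBijective_apply_symm_apply _ (hbij j hs₀B) y
  have hrinv' : ∀ j (ξ : singularCohomology ℂ ℂ (tubeOver f B) j), rinv j (fiberRestrict f hs₀B j ξ) = ξ :=
    fun j ξ ↦ Equiv.ofBijective_symm_apply_apply _ (hbij j hs₀B) ξ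
  have hrinv_add : ∀ j (y y' : complexBetti (fiberOver f s₀) j), rinv j (y + y') = rinv j y + rinv j y' := by
    intro j y y'
    apply (hbij j hs₀B).1
    rw [map_add, hrinv, hrinv, hrinv]
  set ζ : singularCohomology ℂ ℂ (tubeOver f B) P.1.1 :=
    rinv P.1.1 (primitivePart (complexBetti.map (fiberι f s₀) 2 K) n (hK s₀) (hvan_fibre hf s₀) P
      (complexBetti.map (fiberι f s₀) i A)) with hζ
  refine FiberClass.continuousAt_of_eventually_eq_tubeSection (Φ := fun s : ComplexPoints S ↦
      (⟨s, primitivePart (complexBetti.map (fiberι f s) 2 K) n (hK s) (hvan_fibre hf s) P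
        (complexBetti.map (fiberι f s) i A)⟩ : FiberClass f P.1.1))
    continuous_id.continuousAt hBo ζ ?_
  filter_upwards [hBo.mem_nhds hs₀B] with s hsB
  refine ⟨hsB, ?_⟩
  let T : ∀ j, complexBetti (fiberOver f s₀) j →+ complexBetti (fiberOver f s) j := fun j ↦
    { toFun := fun y ↦ fiberRestrict f hsB j (rinv j y)
      map_zero' := by
        have h0 : rinv j 0 = 0 := (hbij j hs₀B).1 (by rw [hrinv, map_zero])
        rw [h0, map_zero]
      map_add' := fun y y' ↦ by rw [hrinv_add, map_add] }
  have hT_apply : ∀ j (ξ : singularCohomology ℂ ℂ (tubeOver f B) j),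
      T j (fiberRestrict f hs₀B j ξ) = fiberRestrict f hsB j ξ := fun j ξ ↦ by
    change fiberRestrict f hsB j (rinv j (fiberRestrict f hs₀B j ξ)) = _
    rw [hrinv']
  have hT_global : ∀ j (G : complexBetti 𝒳 j),
      T j (complexBetti.map (fiberι f s₀) j G) = complexBetti.map (fiberι f s) j G := fun j G ↦ by
    rw [← fiberRestrict_restrictTube_apply f hs₀B j G, hT_apply, fiberRestrict_restrictTube_apply]
  have hT : ∀ (k l : ℕ) (h : 2 + k = l) (x : complexBetti (fiberOver f s₀) k),
      T l (lefschetzOperator (complexBetti.map (fiberι f s₀) 2 K) h x) =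
        lefschetzOperator (complexBetti.map (fiberι f s) 2 K) h (T k x) := by
    intro k l h x
    obtain ⟨ξ, rfl⟩ := (hbij k hs₀B).2 x
    have e1 : cupProduct h (fiberRestrict f hs₀B 2 (restrictTube f B 2 K)) (fiberRestrict f hs₀B k ξ) =
        fiberRestrict f hs₀B l (cupProduct h (restrictTube f B 2 K) ξ) :=
      (cupProduct_map (fiberToTube f hs₀B) h _ _).symm
    have e2 : cupProduct h (fiberRestrict f hsB 2 (restrictTube f B 2 K)) (fiberRestrict f hsB k ξ) =
        fiberRestrict f hsB l (cupProduct h (restrictTube f B 2 K) ξ) :=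
      (cupProduct_map (fiberToTube f hsB) h _ _).symm
    rw [hT_apply k ξ, Literature.Geometry.Kaehler.lefschetzOperator_apply,
      Literature.Geometry.Kaehler.lefschetzOperator_apply, ← fiberRestrict_restrictTube_apply f hs₀B 2 K,
      ← fiberRestrict_restrictTube_apply f hsB 2 K, e1, e2, hT_apply]
  change (⟨s, _⟩ : FiberClass f P.1.1) = ⟨s, fiberRestrict f hsB P.1.1 ζ⟩
  rw [FiberClass.mk_eq_mk_iff, hζ]
  change _ = T P.1.1 (primitivePart (complexBetti.map (fiberι f s₀) 2 K) n (hK s₀) (hvan_fibre hf s₀) P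
    (complexBetti.map (fiberι f s₀) i A))
  rw [map_primitivePart_of_semiconj (hK s₀) (hvan_fibre hf s₀) (hK s) (hvan_fibre hf s) T hT P, hT_global]

/-- **Stability of `Im j_t^*` under the primitive projections, general family, from the named fact
`deligne1968_invariantClass_fromTotalSpace`**: for every global `K` with hard Lefschetz on all fibres, every
global `A ∈ Hⁱ(𝒳(ℂ); ℂ)`, every Lefschetz index `P = (a, t)` and every `t₀`, the primitive part
`ξ_P^{(t₀)}(A|_{X_{t₀}})` is the restriction of a global class `B ∈ Hᵃ(𝒳(ℂ); ℂ)`.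
[cite: VoisinHodgeII2003, §4.3.1 Thm. 4.18 (with Lemma 4.17)] [cite: Deligne1968, Prop. 2.1 and (2.6.3)] -/
theorem exists_primitivePart_map_fiberι_eq_family (h418 : deligne1968_invariantClass_fromTotalSpace)
    (hS : IsSmoothProjective m S) (hf : IsSmoothProjectiveFamily f n) (h𝒳 : IsSmoothProjective N 𝒳)
    (K : complexBetti 𝒳 2) (hK : ∀ s : ComplexPoints S, HasHardLefschetzProperty (complexBetti.map (fiberι f s) 2 K) n)
    {i : ℕ} (A : complexBetti 𝒳 i) (P : {p : ℕ × ℕ // p.1 + 2 * p.2 = i}) (t₀ : ComplexPoints S) :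
    ∃ B : complexBetti 𝒳 P.1.1,
      primitivePart (complexBetti.map (fiberι f t₀) 2 K) n (hK t₀) (hvan_fibre hf t₀) P
        (complexBetti.map (fiberι f t₀) i A) = complexBetti.map (fiberι f t₀) P.1.1 B := by
  haveI := hS.smoothOfRelativeDimension
  obtain ⟨B, hB⟩ := h418 𝒳 S f n hf
    (IsQuasiProjectiveOver.of_isProjectiveOver h𝒳.isProjectiveOver)
    (IsQuasiProjectiveOver.of_isProjectiveOver hS.isProjectiveOver)
    (SmoothOfRelativeDimension.smooth m S.hom) P.1.1 _ (continuous_primitivePartSection_family hS hf K hK A P)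
    (fun _ ↦ rfl) t₀
  exact ⟨B, (FiberClass.mk_eq_mk_iff _ _).1 hB⟩

end Literature.AlgebraicGeometry.HodgeTheory.SmoothFamilyGysinKernel

end
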